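import Mathlib
import Summits.ValiantsHypothesis.ValiantsHypothesis.Theses.CirculantFourier

/-!
# Fourier positivity of the circulant permanent (route CirculantFourier, item `FourierPositivity`)

We prove `Summit.ValiantsHypothesis.ValiantsHypothesis.Theses.CirculantFourier.FourierPositivity`:
for `n ≥ 1` the Fourier form
`QF_n(μ) := aeval (d ↦ ∑ m, C (exp (2πi·d·m/n)) * X m) (per (circulant X))`
is the image of a polynomial with coefficients in `ℝ≥0`.

Proof (boson-sampling positivity / permanent Cauchy–Binet, cf. AaronsonArkhipovToC2013 §3):
put `ζ := exp (2πi/n)` and, for `s : Fin n → Fin n`, `per_s := ∑ σ, ∏ i, ζ ^ (σ i * s i)`.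
Expanding the permanent, writing `ζ ^ ((σ i - i) m) = ζ ^ (σ i * m) * conj (ζ ^ (i * m))` and
averaging over the reparametrisations `s ↦ s ∘ τ` (`τ ∈ S_n`) gives the polynomial identity
`n! • QF_n = ∑ s, C (per_s * conj per_s) * ∏ i, X (s i)`,
whose right-hand side visibly has coefficients `|per_s|² ≥ 0`.
-/

open scoped BigOperators ComplexConjugate
open Finset MvPolynomial

-- `Summit.ValiantsHypothesis.ValiantsHypothesis.…` is the tree's mandated single-conjunct layout
-- (Sub = Summit), so the duplicated namespace component is intended.
set_option linter.dupNamespace false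

namespace Summit.ValiantsHypothesis.ValiantsHypothesis.Theorems

/-- Expansion of the substituted circulant permanent as a double sum over `σ ∈ S_n` and maps
`s : Fin n → Fin n`. -/
theorem fourierPositivity_expand (n : ℕ) (c : Fin n → Fin n → ℂ) :
    MvPolynomial.aeval (fun d : Fin n => ∑ m : Fin n, C (c d m) * X m)
        (Matrix.circulant fun i : Fin n => (X i : MvPolynomial (Fin n) ℂ)).permanent
      = ∑ σ : Equiv.Perm (Fin n), ∑ s : Fin n → Fin n,
          C (∏ i, c (σ i - i) (s i)) * ∏ i, (X (s i) : MvPolynomial (Fin n) ℂ) := by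
  unfold Matrix.permanent
  simp only [map_sum, map_prod, Matrix.circulant_apply, aeval_X]
  refine Finset.sum_congr rfl fun σ _ => ?_
  rw [Fintype.prod_sum]
  refine Finset.sum_congr rfl fun s _ => ?_
  exact prod_mul_distrib

/-- Root-of-unity bookkeeping: `exp (2πi·d·m/n) = ζ ^ (d * m)` with `ζ = exp (2πi/n)`. -/
theorem fourierPositivity_exp_eq_pow (n d m : ℕ) :
    Complex.exp (2 * Real.pi * Complex.I * (d : ℂ) * (m : ℂ) / (n : ℂ))
      = Complex.exp (2 * Real.pi * Complex.I / (n : ℂ)) ^ (d * m) := by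
  rw [← Complex.exp_nat_mul]
  congr 1
  push_cast
  ring

/-- For an `n`-th root of unity `ζ` of modulus one and `a b : Fin n`,
`ζ ^ ((a - b) * m) = ζ ^ (a * m) * conj (ζ ^ (b * m))`. -/
theorem fourierPositivity_pow_sub {n : ℕ} {ζ : ℂ} (hζn : ζ ^ n = 1) (hζ1 : ‖ζ‖ = 1)
    (a b : Fin n) (m : ℕ) :
    ζ ^ (((a - b : Fin n) : ℕ) * m) = ζ ^ ((a : ℕ) * m) * conj (ζ ^ ((b : ℕ) * m)) := by
  have hmod : ∀ x : ℕ, ζ ^ (x % n) = ζ ^ x := fun x => by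
    conv_rhs => rw [← Nat.mod_add_div x n, pow_add, pow_mul, hζn, one_pow, mul_one]
  have hinv : ζ ^ ((n - (b : ℕ)) * m) = (ζ ^ ((b : ℕ) * m))⁻¹ := by
    apply eq_inv_of_mul_eq_one_left
    rw [← pow_add, ← add_mul, Nat.sub_add_cancel b.isLt.le, pow_mul, hζn, one_pow]
  rw [Fin.val_sub, pow_mul, hmod, ← pow_mul, add_mul, pow_add, hinv,
    Complex.inv_eq_conj (by simp [hζ1]), mul_comm]

/-- Reparametrisation invariance of `per_s := ∑ σ, ∏ i, ζ ^ (σ i * s i)` under `s ↦ s ∘ τ`. -/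
theorem fourierPositivity_per_comp {n : ℕ} (ζ : ℂ) (s : Fin n → Fin n)
    (τ : Equiv.Perm (Fin n)) :
    ∑ σ : Equiv.Perm (Fin n), ∏ i, ζ ^ ((σ i : ℕ) * (s (τ i) : ℕ))
      = ∑ σ : Equiv.Perm (Fin n), ∏ i, ζ ^ ((σ i : ℕ) * (s i : ℕ)) := by
  have h : ∀ σ : Equiv.Perm (Fin n),
      ∏ i, ζ ^ ((σ i : ℕ) * (s (τ i) : ℕ)) = ∏ i, ζ ^ (((σ * τ⁻¹) i : ℕ) * (s i : ℕ)) :=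
    fun σ => Fintype.prod_equiv τ _ _ (fun i => by simp [Equiv.Perm.mul_apply])
  simp_rw [h]
  exact Equiv.sum_comp (Equiv.mulRight τ⁻¹)
    (fun σ : Equiv.Perm (Fin n) => ∏ i, ζ ^ ((σ i : ℕ) * (s i : ℕ)))

/-- The diagonal phases summed over reparametrisations give `per_s` again:
`∑ τ, ∏ i, ζ ^ (i * s (τ i)) = ∑ σ, ∏ i, ζ ^ (σ i * s i)`. -/
theorem fourierPositivity_sum_diag_comp {n : ℕ} (ζ : ℂ) (s : Fin n → Fin n) :
    ∑ τ : Equiv.Perm (Fin n), ∏ i : Fin n, ζ ^ ((i : ℕ) * (s (τ i) : ℕ))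
      = ∑ σ : Equiv.Perm (Fin n), ∏ i, ζ ^ ((σ i : ℕ) * (s i : ℕ)) := by
  have h : ∀ τ : Equiv.Perm (Fin n),
      ∏ i : Fin n, ζ ^ ((i : ℕ) * (s (τ i) : ℕ)) = ∏ i : Fin n, ζ ^ ((τ⁻¹ i : ℕ) * (s i : ℕ)) :=
    fun τ => Fintype.prod_equiv τ _ _ (fun i => by simp)
  simp_rw [h]
  exact Equiv.sum_comp (Equiv.inv (Equiv.Perm (Fin n)))
    (fun σ : Equiv.Perm (Fin n) => ∏ i, ζ ^ ((σ i : ℕ) * (s i : ℕ)))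

/-- Averaging over `S_n`: `n! • ∑ s, G s = ∑ s, ∑ τ, G (s ∘ τ)` for any `G` on maps
`Fin n → Fin n`. -/
theorem fourierPositivity_symmetrise {n : ℕ} {M : Type*} [AddCommMonoid M]
    (G : (Fin n → Fin n) → M) :
    (Nat.factorial n) • ∑ s : Fin n → Fin n, G s
      = ∑ s : Fin n → Fin n, ∑ τ : Equiv.Perm (Fin n), G (s ∘ τ) := by
  have hτ : ∀ τ : Equiv.Perm (Fin n), ∑ s : Fin n → Fin n, G (s ∘ τ) = ∑ s, G s := fun τ =>
    Fintype.sum_equiv (Equiv.arrowCongr τ.symm (Equiv.refl (Fin n))) _ _ (fun s => rfl)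
  rw [Finset.sum_comm, Finset.sum_congr rfl (fun τ _ => hτ τ), Finset.sum_const, Finset.card_univ,
    Fintype.card_perm, Fintype.card_fin]

/-- The key polynomial identity behind Fourier positivity:
`n! • QF_n = ∑ s, C (per_s * conj per_s) * ∏ i, X (s i)` with `ζ = exp (2πi/n)` and
`per_s = ∑ σ, ∏ i, ζ ^ (σ i * s i)`. -/
theorem fourierPositivity_key {n : ℕ} (hn : n ≠ 0) :
    (Nat.factorial n : ℂ) • MvPolynomial.aeval
        (fun d : Fin n => ∑ m : Fin n, MvPolynomial.C (Complex.exp (2 * Real.pi * Complex.I *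
          ((d : ℕ) : ℂ) * ((m : ℕ) : ℂ) / (n : ℂ))) * MvPolynomial.X m)
        (Matrix.circulant fun i : Fin n => (MvPolynomial.X i : MvPolynomial (Fin n) ℂ)).permanent
      = ∑ s : Fin n → Fin n,
          C ((∑ σ : Equiv.Perm (Fin n),
                ∏ i, Complex.exp (2 * Real.pi * Complex.I / (n : ℂ)) ^ ((σ i : ℕ) * (s i : ℕ)))
            * conj (∑ σ : Equiv.Perm (Fin n),
                ∏ i, Complex.exp (2 * Real.pi * Complex.I / (n : ℂ)) ^ ((σ i : ℕ) * (s i : ℕ))))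
          * ∏ i, (X (s i) : MvPolynomial (Fin n) ℂ) := by
  set ζ : ℂ := Complex.exp (2 * Real.pi * Complex.I / (n : ℂ)) with hζdef
  have hζ : IsPrimitiveRoot ζ n := Complex.isPrimitiveRoot_exp n hn
  have hζn : ζ ^ n = 1 := hζ.pow_eq_one
  have hζ1 : ‖ζ‖ = 1 := hζ.norm'_eq_one hn
  -- Step 1: expand and rewrite the phases.
  have hphase : ∀ (σ : Equiv.Perm (Fin n)) (s : Fin n → Fin n),
      ∏ i, Complex.exp (2 * Real.pi * Complex.I * (((σ i - i : Fin n) : ℕ) : ℂ) *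
          ((s i : ℕ) : ℂ) / (n : ℂ))
        = (∏ i, ζ ^ ((σ i : ℕ) * (s i : ℕ))) * conj (∏ i : Fin n, ζ ^ ((i : ℕ) * (s i : ℕ))) := by
    intro σ s
    rw [map_prod, ← prod_mul_distrib]
    refine Finset.prod_congr rfl fun i _ => ?_
    rw [fourierPositivity_exp_eq_pow, ← hζdef, fourierPositivity_pow_sub hζn hζ1]
  rw [fourierPositivity_expand]
  simp_rw [hphase]
  -- Step 2: swap the sums; the inner sum over `σ` produces `per_s`.
  set per : (Fin n → Fin n) → ℂ :=
    fun s => ∑ σ : Equiv.Perm (Fin n), ∏ i, ζ ^ ((σ i : ℕ) * (s i : ℕ)) with hper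
  have hswap : ∑ σ : Equiv.Perm (Fin n), ∑ s : Fin n → Fin n,
        C ((∏ i, ζ ^ ((σ i : ℕ) * (s i : ℕ))) * conj (∏ i : Fin n, ζ ^ ((i : ℕ) * (s i : ℕ))))
          * ∏ i, (X (s i) : MvPolynomial (Fin n) ℂ)
      = ∑ s : Fin n → Fin n,
          C (per s * conj (∏ i : Fin n, ζ ^ ((i : ℕ) * (s i : ℕ))))
            * ∏ i, (X (s i) : MvPolynomial (Fin n) ℂ) := by
    rw [Finset.sum_comm]
    refine Finset.sum_congr rfl fun s _ => ?_
    rw [hper, Finset.sum_mul, map_sum, Finset.sum_mul]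
  rw [hswap, Nat.cast_smul_eq_nsmul, fourierPositivity_symmetrise]
  refine Finset.sum_congr rfl fun s _ => ?_
  -- Step 3: the sum over reparametrisations of a fixed `s`.
  have hX : ∀ τ : Equiv.Perm (Fin n),
      ∏ i, (X ((s ∘ τ) i) : MvPolynomial (Fin n) ℂ) = ∏ i, X (s i) := fun τ =>
    Equiv.prod_comp τ (fun i => (X (s i) : MvPolynomial (Fin n) ℂ))
  have hP : ∀ τ : Equiv.Perm (Fin n), per (s ∘ τ) = per s := fun τ => by
    simp only [hper, Function.comp_apply]
    exact fourierPositivity_per_comp ζ s τ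
  simp_rw [hX, hP, ← Finset.sum_mul, ← map_sum, ← Finset.mul_sum, Function.comp_apply, ← map_sum,
    fourierPositivity_sum_diag_comp ζ s]
  simp only [hper]

/-- **Fourier positivity** (item `stmt-ValiantsHypothesis-6306` of route CirculantFourier):
for every `n ≥ 1` the Fourier form of the circulant permanent is the image of an
`ℝ≥0`-polynomial; explicitly one may take `g = ∑ s, C (|per_s|² / n!) * ∏ i, X (s i)`, the sum
over all maps `s : Fin n → Fin n`, with `per_s = ∑ σ, ∏ i, ζ ^ (σ i * s i)`, `ζ = exp (2πi/n)`. -/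
theorem fourierPositivity_proof :
    Summit.ValiantsHypothesis.ValiantsHypothesis.Theses.CirculantFourier.FourierPositivity := by
  unfold Summit.ValiantsHypothesis.ValiantsHypothesis.Theses.CirculantFourier.FourierPositivity
  intro n hn
  have hn0 : n ≠ 0 := by omega
  have hfac : (Nat.factorial n : ℂ) ≠ 0 := Nat.cast_ne_zero.mpr (Nat.factorial_ne_zero n)
  refine ⟨∑ s : Fin n → Fin n,
    C ((Nat.factorial n : NNReal)⁻¹ *
        ⟨Complex.normSq (∑ σ : Equiv.Perm (Fin n), ∏ i : Fin n,
            Complex.exp (2 * Real.pi * Complex.I / (n : ℂ)) ^ ((σ i : ℕ) * (s i : ℕ))),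
          Complex.normSq_nonneg _⟩) * ∏ i, X (s i), ?_⟩
  have hcoef : ∀ z : ℂ, (Complex.ofRealHom.comp NNReal.toRealHom)
      ((Nat.factorial n : NNReal)⁻¹ * ⟨Complex.normSq z, Complex.normSq_nonneg _⟩)
        = (Nat.factorial n : ℂ)⁻¹ * (z * conj z) := by
    intro z
    rw [map_mul, map_inv₀, map_natCast, Complex.mul_conj]
    rfl
  have key2 : MvPolynomial.aeval
        (fun d : Fin n => ∑ m : Fin n, MvPolynomial.C (Complex.exp (2 * Real.pi * Complex.I *
          ((d : ℕ) : ℂ) * ((m : ℕ) : ℂ) / (n : ℂ))) * MvPolynomial.X m)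
        (Matrix.circulant fun i : Fin n => (MvPolynomial.X i : MvPolynomial (Fin n) ℂ)).permanent
      = C ((Nat.factorial n : ℂ)⁻¹) * ∑ s : Fin n → Fin n,
          C ((∑ σ : Equiv.Perm (Fin n),
                ∏ i, Complex.exp (2 * Real.pi * Complex.I / (n : ℂ)) ^ ((σ i : ℕ) * (s i : ℕ)))
            * conj (∑ σ : Equiv.Perm (Fin n),
                ∏ i, Complex.exp (2 * Real.pi * Complex.I / (n : ℂ)) ^ ((σ i : ℕ) * (s i : ℕ))))
          * ∏ i, (X (s i) : MvPolynomial (Fin n) ℂ) := by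
    rw [← fourierPositivity_key hn0, smul_eq_C_mul, ← mul_assoc, ← C_mul, inv_mul_cancel₀ hfac,
      C_1, one_mul]
  rw [key2, map_sum, Finset.mul_sum]
  refine Finset.sum_congr rfl fun s _ => ?_
  rw [map_mul, map_C, hcoef, map_prod, C_mul, mul_assoc]
  simp only [map_X]

end Summit.ValiantsHypothesis.ValiantsHypothesis.Theorems
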